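import Summits.QuantumFields.YangMills.Theorems.BalabanUVNodesN15KingModelGraphTreeDecayProp36Kruskal
import Summits.QuantumFields.YangMills.Theorems.BalabanUVNodesN15KingModelGraphReplacementExtLines

/-!
# BalabanUVNodes ∕ N15 — THE KING-MODEL RUNG (PART Α-g): (3.56) WITH ITS TREE DECAY FOR GRAPHS WITH KING's OWN EXTERNAL LINES — the one-vertex factors of part
# Α-f ARE the external lines `a_KG^η_KQ_K^*(x, y_υ) = ℋ_K(x, y_υ)` ∕ `∂^η_μℋ_K(x, y_υ)` of Proposition 3.8 (3.71) to unit sites `y_υ` (part Η-e), their sizes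
# (Theorem 3.3 ∕ [Ba4] (1.10), mass-uniform) and rates (Proposition 3.8 BY NAME) supply every one-vertex hypothesis, so NO abstract majorant is left:
# `|E^{(K+n)}(H) − E^{(K)}(H)| ≤ exp[−δ·d_tree({y_υ})]·(rate `L^{−γK}` × constants)` for every connected `G`∕`∂G` graph satisfying p. 664's sentence
# (Track A, DAG node N15 = NE2; FAN-OUT v1.1 §N15 s3 «KING-MODEL RUNG … NE2's analogue DECIDED in the model»)

HONEST FRAMING.  Count-neutral (cell `pub-ymgap`, seat `pub-ymgap-dag-n15-e` g29; `--supports stmt-QuantumFields-27366 --as helper` = K3⁸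
`SpineGivenEndpointR13SepCoPHV`).  TEMPLATE LITERATURE: C. King, *The U(1) Higgs model. I. The continuum limit*, Commun. Math. Phys. **102** (1986) 649–677
[King1986], Proposition 3.6 (3.56) p. 662 with Proposition 3.8 (3.71) p. 664 and Theorem 3.3 (3.7) p. 658 for the external lines — KING's OWN `A = 0`
MODEL on the rung's tori; Props. 3.7∕3.8∕3.9 BY NAME (Ω₂ `king_props37_38_39_commonConstants`), the external-line sizes by the typer's mass-uniform
[Ba4] (1.10) (part Η-e `kingExt_sizes_unif`).  NOT Bałaban's non-abelian `G(U)` of [B9]; NOT a node discharge; nothing continuum ∕ ℝ⁴ ∕ OS ∕ mass-gap ∕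
Clay.  0 `sorry`; standard axioms.  Text layer of pp. 658–666 (`paper:king1986-cmp102-king-u1-higgs-i` p0010–p0018) re-read by this seat 2026-08-29.

THE PRINT.  p. 662 [PDF 14] (3.56): *«|E^{(k)}(H; {y_i}, {z_q}, {w_l}) − E^{(k+n)}(H; …)| ≤ C(L^kε)^{…} L^{−γk} exp[−δ d(…, {y_i}, {z_q}, {w_l})]»*; p. 664
[PDF 16]: *«First, we replace the propagators on the external lines, using … Proposition 3.8 … ≤ CL^{−γk} exp[−δ₀|x − z|]»* (3.71); *«By extracting a small part
of each propagator, we get the exponential decay on the right-hand side of (3.56).»*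

READING (declared; ours).  An external line `υ` runs from the internal vertex `vtx υ` to the base point `y_υ = basePt b_υ` of a unit block `b_υ` and carries
`ℋ_K(x, y_υ)` or `∂^η_μℋ_K(x, y_υ)` (part Η-e `kingExtLo`; fine: `kingExtHi`, King's `a_{K+n}G^{η′}_{K+n}Q^*_{K+n}(x′, z)`).  ITS SIZE decays in the block distance
(part Η-e: `a·cₑ·e^{−δₑ|B(x) − b_υ|_T}`, both lattices), which in the unit-block distance `|x − y_υ| = tdistT∕L^K` costs `e^{δₑ}` (`|x − y_b| ≤ |B(x) − b|_T + 1`);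
ITS RATE is (3.71): `C L^{−γK} e^{−δ₀|x − y_υ|}`.  With `Q = max(a cₑ e^{δₑ}, C)` and `δ_E = min(δₑ, δ₀)` every leg satisfies part Α-f's anchored hypotheses
with `qq_υ = Q`, `s_υ = L^{−γK}`, `δ′ = δ_E∕2`, anchors `some y_υ`; the root leg `υ₀` keeps half of its decay as the `L¹` majorant `p₀ = Q·e^{−(δ_E∕2)|x − y₀|}`
(`Σ_x η^{d+1}p₀ ≤ Q·c368(δ_E∕2)` by (3.68), INDEPENDENT OF THE VOLUME — the leg pins its vertex, no `|□′|` needed) and gives the other half to the tree.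

WHAT THIS FILE PROVES (namespace `Summit.QuantumFields.YangMills.BalabanUVNodes.N15KingModelRung.Curved`).
* §1 letters: `exp_blockDist_le_exp_kingDist` (block decay ⇒ unit-block decay, cost `e^{δₑ}`), `profileAt_top_eq` (the profile at the unit slice `c = K` is
  `C·e^{−δ|x − y|}`), ★ `kingExt_legs_anchored` (sizes and rates of both kernel members of (3.71) in part Α-f's anchored form, mass-uniformly, one `(Q, δ_E, γ)`).
* §2 ★★ `king_prop36_extLegs_pairDecay` (two of the external points: decay `exp[−δ|y_{υ₀} − y_{υ₁}|]`, the two-point reading) and ★★★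
  **`king_prop36_extLegs_treeDecay_collected`** (`≤ e^{−δ d}·L^{−γK}·A^{2m+nn+|Υ|}·m!·(m+|Υ|+1)`, ONE `A ≥ 1` — (3.56) as one reads it) after
  ★★★ **`king_prop36_extLegs_treeDecay`** — KING 1986 PROPOSITION 3.6 (3.56) FOR CONNECTED GRAPHS WITH KING's EXTERNAL LINES, «EVERY SUBGRAPH HAS POSITIVE
  DEGREE» (p. 664), BY NAME AT `A = 0`, WITH BOTH THE RATE AND THE TREE DECAY: one `(C₁, C₂, Q, γ, δ)` for odd `L ≥ 3`, `a > 0`, `m₀² ≥ 0` such that for every mass,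
  volume, `K ≥ 1`, `n ≥ 1`, every connected numbered `G`∕`∂G` graph with `PosSubgraphsBy … 0 (d+1) (lineExp ∘ κ)`, every family of external lines (blocks `b_υ`,
  kinds `κₑ_υ`, one of them at the vertex `0`):
  `|E^{(K+n)}(H) − E^{(K)}(H)| ≤ exp[−δ·treeLength |·| {y_υ}]·(Γ′ + Γ·(L^{−min(γ,¼)K}(m+1) + (|Υ|−1)·L^{−γK}))·C₁^m·C₂^{nn}·(m!·(1 − L^{−¼})^{−m})·Q^{|Υ|−1}`
  with `Γ = Q·c368(δ)`, `Γ′ = Q·L^{−γK}·c368(δ)` — every term carries `L^{−min(γ,¼)K}`, nothing depends on the volume.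

HONEST SCOPE.  (a) King's `A = 0` model; external lines = the two kernel members of (3.71) to unit base points (the Hölder members, the sources `g, h, χ`, the
dressings (3.46) and the fields `A(w_l)` are not placed — they enter parts Α-e∕Α-f as abstract anchored factors); §3.5∕Thm 3.5 NOT typed (the subgraph condition
is the hypothesis; parts Δ-d…Δ-j decide it per graph).  (b) `treeLength` = minimum over connecting edge sets (King's tree minimum by pruning, not typed).
(c) NOT Bałaban's `G(U)`; NE2 ∕ N15 untouched; counts unmoved.  Locators: [King1986] Prop. 3.6 (3.56) p.662, Prop. 3.8 (3.71) p.664, Thm 3.3 (3.7) p.658,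
(3.68) p.664, p.660, p.664, (3.77) p.666.
-/

noncomputable section

namespace Summit.QuantumFields.YangMills.BalabanUVNodes.N15KingModelRung.Curved

open scoped BigOperators
open Finset
open Literature.MathematicalPhysics.QuantumFieldTheory.Balaban1983to89.B5Prop11Plancherel (Tor fine)
open Literature.MathematicalPhysics.QuantumFieldTheory.King1986.Torus (tdistT tdistT_nonneg tdistT_symm blockOf)
open Literature.MathematicalPhysics.QuantumFieldTheory.King1986.SlicePropagator (Prop37PrintedAt Prop38PrintedAt Prop39PrintedAt)
open Literature.MathematicalPhysics.QuantumFieldTheory.King1986.ContinuumLimit (eps)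
open Summit.QuantumFields.YangMills.BalabanUVNodes.N15KingModelRung (KingVolIndex kingVol kingVol_neZero basePt blockOf_basePt)
open Summit.QuantumFields.YangMills.BalabanUVNodes.N15KingModelRung.Graph

variable {d : ℕ} (L : ℕ) [NeZero L]

/-! ## §1 Letters: block decay in unit-block currency; the unit-slice profile; the legs in anchored form -/

section Letters

/-- **BLOCK DECAY IN UNIT-BLOCK CURRENCY**: `e^{−δ|B(x) − b|_T} ≤ e^{δ}·e^{−δ|x − y_b|}` for `δ ≥ 0`, `y_b = basePt b`, `|x − y| = tdistT∕L^K` — since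
`|x − y_b|_{fine} ≤ L^K|B(x) − b|_T + L^K − 1` (part Ψ `tdistT_fine_le_blocks`). [cite: King1986, (3.64) p.663, p.664 (pairing)] -/
theorem exp_blockDist_le_exp_kingDist (hL : 1 ≤ L) (jv : KingVolIndex d) {δ : ℝ} (hδ : 0 ≤ δ) (b : Tor (kingVol L jv))
    (x : haveI := kingVol_neZero L jv; Tor (fine (L ^ jv.K) (kingVol L jv))) :
    haveI := kingVol_neZero L jv
    Real.exp (-(δ * tdistT (kingVol L jv) (blockOf (L ^ jv.K) (kingVol L jv) x) b))
      ≤ Real.exp δ * Real.exp (-(δ * kingDist L jv x (basePt (L ^ jv.K) (kingVol L jv) b))) := by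
  haveI := kingVol_neZero L jv
  have hL0 : (0 : ℝ) < L := by exact_mod_cast (show 0 < L by omega)
  have hN : (0 : ℝ) < (L : ℝ) ^ jv.K := pow_pos hL0 _
  have h := tdistT_fine_le_blocks (L ^ jv.K) (kingVol L jv) x (basePt (L ^ jv.K) (kingVol L jv) b)
  rw [blockOf_basePt] at h
  push_cast at h
  have hdist : kingDist L jv x (basePt (L ^ jv.K) (kingVol L jv) b) ≤ tdistT (kingVol L jv) (blockOf (L ^ jv.K) (kingVol L jv) x) b + 1 := by
    unfold kingDist
    rw [div_le_iff₀ hN]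
    nlinarith
  rw [← Real.exp_add]
  exact Real.exp_le_exp.2 (by nlinarith [mul_le_mul_of_nonneg_left hdist hδ])

/-- **THE PROFILE AT THE UNIT SLICE** `c = K` (length `L^Kη = 1`): `profileAt_{C,δ}(K, 0)(x, y) = C·e^{−δ|x − y|}`. [cite: King1986, (3.63) p.663, (3.68) p.664] -/
theorem profileAt_top_eq (jv : KingVolIndex d) (C δ : ℝ) (x y : haveI := kingVol_neZero L jv; Tor (fine (L ^ jv.K) (kingVol L jv))) :
    haveI := kingVol_neZero L jv
    profileAt L jv.K (kingVol L jv) C δ jv.K 0 x y = C * Real.exp (-(δ * kingDist L jv x y)) := by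
  haveI := kingVol_neZero L jv
  have hL0 : (0 : ℝ) < L := by exact_mod_cast Nat.pos_of_ne_zero (NeZero.ne L)
  have h1 : (L : ℝ) ^ jv.K * eps L jv.K = 1 := by unfold eps; exact mul_inv_cancel₀ (pow_ne_zero _ hL0.ne')
  unfold profileAt kingDist
  rw [h1, Real.rpow_zero, inv_one, mul_one, mul_one]

/-- ★ **KING's EXTERNAL LINES IN ANCHORED FORM** — sizes (Thm 3.3 ∕ [Ba4] (1.10), mass-uniform, part Η-e) and rates (Prop. 3.8 (3.71) by name, Ω₂), for both
kernel members, both lattices through the pairing, with ONE `(Q, δ_E, γ)`: for every `0 < m² ≤ m₀²`, `j`, `n ≥ 1`, unit block `b`, kind `κ` and `0 ≤ δ ≤ δ_E`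
(`y_b = basePt b`, `|x − y| = tdistT∕L^K`):  `|ℋ_K(x, y_b)| ≤ Q·e^{−δ|x − y_b|}`, `|ℋ_{K+n}(x′, y_b)| ≤ Q·e^{−δ|pt x′ − y_b|}`,
`|ℋ_{K+n}(x′, y_b) − ℋ_K(pt x′, y_b)| ≤ L^{−γK}·Q·e^{−δ|pt x′ − y_b|}` (and the same for `∂ℋ`). [cite: King1986, Thm 3.3 (3.7) p.658, Prop. 3.8 (3.71) p.664] -/
theorem kingExt_legs_anchored (hLodd : Odd L) (hL : 2 ≤ L) {a : ℝ} (ha : 0 < a) {m0sq : ℝ} (hm0 : 0 ≤ m0sq) :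
    ∃ Q δE γ : ℝ, 0 < Q ∧ 0 < δE ∧ 0 < γ ∧ ∀ (msq : ℝ), 0 < msq → msq ≤ m0sq → ∀ (jv : KingVolIndex d) (n : ℕ), 1 ≤ n →
      ∀ (b : Tor (kingVol L jv)) (κ : Option (Fin (d + 1))) (δ : ℝ), 0 ≤ δ → δ ≤ δE →
      haveI := kingVol_neZero L jv
      (∀ x : Tor (fine (L ^ jv.K) (kingVol L jv)),
        |kingExtLo L a msq jv b κ x| ≤ Q * Real.exp (-(δ * kingDist L jv x (basePt (L ^ jv.K) (kingVol L jv) b)))) ∧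
      (∀ x' : Tor (fine (L ^ (jv.K + n)) (kingVol L jv)),
        |kingExtHi L a msq jv n b κ x'|
          ≤ Q * Real.exp (-(δ * kingDist L jv (kingSlicePt L jv.K n (kingVol L jv) x') (basePt (L ^ jv.K) (kingVol L jv) b)))) ∧
      (∀ x' : Tor (fine (L ^ (jv.K + n)) (kingVol L jv)),
        |kingExtHi L a msq jv n b κ x' - kingExtLo L a msq jv b κ (kingSlicePt L jv.K n (kingVol L jv) x')|
          ≤ (L : ℝ) ^ (-(γ * jv.K)) * Q
              * Real.exp (-(δ * kingDist L jv (kingSlicePt L jv.K n (kingVol L jv) x') (basePt (L ^ jv.K) (kingVol L jv) b)))) := by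
  obtain ⟨C, δ₀, γ, hC, hδ₀, hγ, H⟩ := king_props37_38_39_commonConstants (d := d) L hLodd hL ha hm0 (α := 1 / 2) (by norm_num) (by norm_num)
  obtain ⟨δe, ce, hδe, hce, He⟩ := kingExt_sizes_unif (d := d) (L := L) (a := a) hLodd hL ha hm0
  have hL1 : 1 ≤ L := by omega
  set Q : ℝ := max (a * ce * Real.exp δe) C with hQ
  have hQe : a * ce * Real.exp δe ≤ Q := le_max_left _ _
  have hQC : C ≤ Q := le_max_right _ _
  have hQ0 : 0 < Q := lt_max_of_lt_left (by positivity)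
  refine ⟨Q, min δe δ₀, γ, hQ0, lt_min hδe hδ₀, hγ, fun msq hm hcap jv n hn b κ δ hδ hδE => ?_⟩
  haveI := kingVol_neZero L jv
  obtain ⟨-, -, h38, -⟩ := H msq hm hcap jv n hn
  obtain ⟨hlo, hhi⟩ := He msq hm.le hcap jv n b κ
  have hδe' : δ ≤ δe := hδE.trans (min_le_left _ _)
  have hδ0' : δ ≤ δ₀ := hδE.trans (min_le_right _ _)
  have hρ0 := kingDist_nonneg L jv
  -- the size profile weakened: `a cₑ e^{−δₑ|B(x)−b|} ≤ Q e^{−δ|x − y_b|}`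
  have hsize : ∀ x : Tor (fine (L ^ jv.K) (kingVol L jv)),
      a * ce * Real.exp (-(δe * tdistT (kingVol L jv) (blockOf (L ^ jv.K) (kingVol L jv) x) b))
        ≤ Q * Real.exp (-(δ * kingDist L jv x (basePt (L ^ jv.K) (kingVol L jv) b))) := fun x => by
    have h1 := exp_blockDist_le_exp_kingDist L hL1 jv hδe.le b x
    have h2 : Real.exp (-(δe * kingDist L jv x (basePt (L ^ jv.K) (kingVol L jv) b)))
        ≤ Real.exp (-(δ * kingDist L jv x (basePt (L ^ jv.K) (kingVol L jv) b))) :=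
      Real.exp_le_exp.2 (neg_le_neg (mul_le_mul_of_nonneg_right hδe' (hρ0 _ _)))
    calc a * ce * Real.exp (-(δe * tdistT (kingVol L jv) (blockOf (L ^ jv.K) (kingVol L jv) x) b))
        ≤ a * ce * (Real.exp δe * Real.exp (-(δ * kingDist L jv x (basePt (L ^ jv.K) (kingVol L jv) b)))) :=
          mul_le_mul_of_nonneg_left (h1.trans (mul_le_mul_of_nonneg_left h2 (Real.exp_nonneg _))) (by positivity)
      _ = (a * ce * Real.exp δe) * Real.exp (-(δ * kingDist L jv x (basePt (L ^ jv.K) (kingVol L jv) b))) := by ring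
      _ ≤ Q * Real.exp (-(δ * kingDist L jv x (basePt (L ^ jv.K) (kingVol L jv) b))) := mul_le_mul_of_nonneg_right hQe (Real.exp_nonneg _)
  refine ⟨fun x => ?_, fun x' => ?_, fun x' => ?_⟩
  · have h := hlo x; rw [Real.norm_eq_abs] at h; exact h.trans (hsize x)
  · have h := hhi x'; rw [Real.norm_eq_abs] at h; exact h.trans (hsize _)
  · have h := kingExt_rate_of_prop38 (msq := msq) h38 b κ x'
    rw [Real.norm_eq_abs] at h
    refine h.trans ?_
    have hθ0 : 0 ≤ (L : ℝ) ^ (-(γ * jv.K)) := Real.rpow_nonneg (Nat.cast_nonneg L) _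
    have h2 : Real.exp (-(δ₀ * kingDist L jv (kingSlicePt L jv.K n (kingVol L jv) x') (basePt (L ^ jv.K) (kingVol L jv) b)))
        ≤ Real.exp (-(δ * kingDist L jv (kingSlicePt L jv.K n (kingVol L jv) x') (basePt (L ^ jv.K) (kingVol L jv) b))) :=
      Real.exp_le_exp.2 (neg_le_neg (mul_le_mul_of_nonneg_right hδ0' (hρ0 _ _)))
    calc C * (L : ℝ) ^ (-(γ * jv.K)) * Real.exp (-(δ₀ * (tdistT (fine (L ^ jv.K) (kingVol L jv)) (kingSlicePt L jv.K n (kingVol L jv) x')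
            (basePt (L ^ jv.K) (kingVol L jv) b) / (L : ℝ) ^ jv.K)))
        ≤ Q * (L : ℝ) ^ (-(γ * jv.K)) * Real.exp (-(δ * kingDist L jv (kingSlicePt L jv.K n (kingVol L jv) x') (basePt (L ^ jv.K) (kingVol L jv) b))) :=
          mul_le_mul (mul_le_mul_of_nonneg_right hQC hθ0) h2 (Real.exp_nonneg _) (mul_nonneg hQ0.le hθ0)
      _ = (L : ℝ) ^ (-(γ * jv.K)) * Q * Real.exp (-(δ * kingDist L jv (kingSlicePt L jv.K n (kingVol L jv) x') (basePt (L ^ jv.K) (kingVol L jv) b))) := by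
          ring

end Letters

/-! ## §2 (3.56) with its tree decay for connected graphs with King's external lines, by name at `A = 0` -/

section ExtLegs

/-- ★★★ **KING 1986 PROPOSITION 3.6 (3.56) — RATE AND TREE DECAY — FOR CONNECTED GRAPHS WITH KING's OWN EXTERNAL LINES, «IN WHICH EVERY SUBGRAPH HAS POSITIVE
DEGREE», BY NAME AT `A = 0`.**  For odd `L ≥ 3`, `a > 0`, `m₀² ≥ 0` there are `C₁, C₂, Q, γ, δ > 0` such that for every mass `0 < m² ≤ m₀²`, index `jv` (torus
`2L^{jv.m}`, `K = jv.K ≥ 1`), `n ≥ 1`, every CONNECTED numbered graph (lines `src`, `tgt`, kinds `κ`: King's full `A = 0` propagators `G^η_K`∕`∂^η_μG^η_K` on the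
coarse lattice, `G^{η′}_{K+n}`∕`∂^{η′}_μG^{η′}_{K+n}` on the fine one) satisfying p. 664's sentence `PosSubgraphsBy src tgt 0 (d+1) (lineExp ∘ κ)`, and every family of
EXTERNAL LINES `υ ∈ Υ` (from `vtx υ` to the unit site `y_υ = basePt b_υ`, kind `κₑ_υ`, carrying `ℋ_K(·, y_υ)`∕`∂ℋ_K` resp. `ℋ_{K+n}`∕`∂ℋ_{K+n}`; `υ₀` at the vertex `0`):
`|E^{(K+n)}(H) − E^{(K)}(H)| ≤ exp[−δ·treeLength |·| {y_υ}]·(Q·L^{−γK}·c368(δ) + Q·c368(δ)·(L^{−min(γ,¼)K}(m+1) + Σ_{υ≠υ₀} L^{−γK}))·C₁^m·C₂^{nn}·(m!·(1 − L^{−¼})^{−m})·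
Π_{υ≠υ₀} Q` — (3.56) with BOTH its rate `L^{−γk}` and its tree decay `exp[−δ d({y})]`, every hypothesis on the propagators discharged BY NAME (Props. 3.7∕3.8∕3.9,
Thm 3.3), the volume factor `|□′|` replaced by the root leg's own decay ((3.68): `Q·c368(δ)`).  PROOF: part Α-f `king_prop36_graph_zeroField_treeDecay_subgraphs`
with `qq_υ = Q`, `s_υ = L^{−γK}`, anchors `some y_υ`, leg rate `δ` = half of §1's `δ_E`, `p₀`∕`r₀` = the other half as unit-slice profiles.
[cite: King1986, Prop. 3.6 (3.56) p.662, Prop. 3.8 (3.71) p.664, Thm 3.3 (3.7) p.658, (3.68) p.664, p.660, p.664 («every subgraph has positive degree»; «By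
extracting a small part of each propagator …»), (3.77) p.666] -/
theorem king_prop36_extLegs_treeDecay (hLodd : Odd L) (hL : 2 ≤ L) {a : ℝ} (ha : 0 < a) {m0sq : ℝ} (hm0 : 0 ≤ m0sq) :
    ∃ C₁ C₂ Q γ δ : ℝ, 0 < C₁ ∧ 0 < C₂ ∧ 0 < Q ∧ 0 < γ ∧ 0 < δ ∧ ∀ (msq : ℝ), 0 < msq → msq ≤ m0sq → ∀ (jv : KingVolIndex d) (n : ℕ), 1 ≤ n →
      ∀ (nn m : ℕ) (src tgt : Fin m → Fin (nn + 1)), (∀ v, LConn src tgt univ 0 v) →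
      ∀ (κ : Fin m → Option (Fin (d + 1))), PosSubgraphsBy src tgt 0 ((d + 1 : ℕ) : ℝ) (fun ℓ => lineExp (d + 1) (κ ℓ)) →
      ∀ (Υ : Type) [Fintype Υ] [DecidableEq Υ] (vtx : Υ → Fin (nn + 1)) (υ₀ : Υ), vtx υ₀ = 0 →
      ∀ (b : Υ → Tor (kingVol L jv)) (κe : Υ → Option (Fin (d + 1))),
        haveI := kingVol_neZero L jv
        |graphValLS ((((L : ℝ) ^ (jv.K + n))⁻¹) ^ (d + 1)) src tgt (fun ℓ => kingGLine L (kingVol L jv) a msq (jv.K + n) (κ ℓ)) vtx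
              (fun υ => kingExtHi L a msq jv n (b υ) (κe υ))
            - graphValLS ((((L : ℝ) ^ jv.K)⁻¹) ^ (d + 1)) src tgt (fun ℓ => kingGLine L (kingVol L jv) a msq jv.K (κ ℓ)) vtx
              (fun υ => kingExtLo L a msq jv (b υ) (κe υ))|
          ≤ Real.exp (-(δ * treeLength (kingDist L jv) (anchors fun υ => some (basePt (L ^ jv.K) (kingVol L jv) (b υ)))))
            * ((Q * (L : ℝ) ^ (-(γ * jv.K)) * c368 d δ
                + Q * c368 d δ * ((L : ℝ) ^ (-(min γ (1 / 4) * jv.K)) * (m + 1) + ∑ _υ ∈ univ.erase υ₀, (L : ℝ) ^ (-(γ * jv.K))))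
              * (C₁ ^ m * C₂ ^ nn * ((m.factorial : ℝ) * ((1 - (L : ℝ) ^ (-(1 / 4 : ℝ)))⁻¹) ^ m) * ∏ _υ ∈ univ.erase υ₀, Q)) := by
  obtain ⟨C₁, C₂, γ₀, δ₁, hC₁, hC₂, hγ₀, hδ₁, H⟩ := king_prop36_graph_zeroField_treeDecay_subgraphs (d := d) L hLodd hL ha hm0
  obtain ⟨Q, δE, γE, hQ, hδE, hγE, HE⟩ := kingExt_legs_anchored (d := d) L hLodd hL ha hm0
  have hL1 : 1 ≤ L := by omega
  have hL0 : (0 : ℝ) < L := by exact_mod_cast (show 0 < L by omega)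
  have hL1r : (1 : ℝ) ≤ L := by exact_mod_cast hL1
  -- one rate `γ := min γ₀ γE` and one decay `δ := min δ₁ (δE∕2)`
  set γ : ℝ := min γ₀ γE with hγdef
  set δ : ℝ := min δ₁ (δE / 2) with hδdef
  have hγ0 : 0 < γ := lt_min hγ₀ hγE
  have hδ0 : 0 < δ := lt_min hδ₁ (by linarith)
  have hδE2 : δ ≤ δE / 2 := min_le_right _ _
  refine ⟨C₁, C₂, Q, γ, δ, hC₁, hC₂, hQ, hγ0, hδ0, fun msq hm hcap jv n hn nn m src tgt hconn κ hsub Υ _ _ vtx υ₀ hυ₀ b κe => ?_⟩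
  haveI := kingVol_neZero L jv
  have hρ0 := kingDist_nonneg L jv
  set ρ := kingDist L jv with hρ
  set y : Υ → Tor (fine (L ^ jv.K) (kingVol L jv)) := fun υ => basePt (L ^ jv.K) (kingVol L jv) (b υ) with hy
  set pt := kingSlicePt L jv.K n (kingVol L jv) with hpt
  set θE : ℝ := (L : ℝ) ^ (-(γE * jv.K)) with hθE
  have hθE0 : 0 ≤ θE := Real.rpow_nonneg hL0.le _
  -- the legs at rate `2δ ≤ δ_E`: sizes `Q e^{−2δ|x − y|}`, rates `θE·Q·e^{−2δ|x − y|}`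
  have h2δ : 2 * δ ≤ δE := by linarith
  have HL := fun υ => HE msq hm hcap jv n hn (b υ) (κe υ) (2 * δ) (by linarith) h2δ
  -- splitting `e^{−2δρ} = e^{−δρ}·e^{−δρ}` = (majorant part)·(legWeight δ)
  have hsplit : ∀ x z : Tor (fine (L ^ jv.K) (kingVol L jv)),
      Real.exp (-(2 * δ * ρ x z)) = Real.exp (-(δ * ρ x z)) * legWeight δ ρ (some z) x := fun x z => by
    rw [legWeight_some, ← Real.exp_add]; congr 1; ring
  have hw1 : ∀ x z : Tor (fine (L ^ jv.K) (kingVol L jv)), Real.exp (-(δ * ρ x z)) ≤ 1 := fun x z =>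
    Real.exp_le_one_iff.2 (neg_nonpos.2 (mul_nonneg hδ0.le (hρ0 x z)))
  -- the root leg's `L¹` majorants as unit-slice profiles
  set p₀ : Tor (fine (L ^ jv.K) (kingVol L jv)) → ℝ := fun x => profileAt L jv.K (kingVol L jv) Q δ jv.K 0 x (y υ₀) with hp₀def
  set r₀ : Tor (fine (L ^ jv.K) (kingVol L jv)) → ℝ := fun x => profileAt L jv.K (kingVol L jv) (θE * Q) δ jv.K 0 x (y υ₀) with hr₀def
  have hp₀eq : ∀ x, p₀ x = Q * Real.exp (-(δ * ρ x (y υ₀))) := fun x => profileAt_top_eq L jv Q δ x (y υ₀)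
  have hr₀eq : ∀ x, r₀ x = θE * Q * Real.exp (-(δ * ρ x (y υ₀))) := fun x => profileAt_top_eq L jv (θE * Q) δ x (y υ₀)
  have hp₀0 : ∀ x, 0 ≤ p₀ x := fun x => by rw [hp₀eq]; positivity
  have hr₀0 : ∀ x, 0 ≤ r₀ x := fun x => by rw [hr₀eq]; positivity
  have h1K : (1 : ℝ) = ((L : ℝ) ^ jv.K * eps L jv.K) := by unfold eps; rw [mul_inv_cancel₀ (pow_ne_zero _ hL0.ne')]
  have hΓ : ∑ x, (((L : ℝ) ^ jv.K)⁻¹) ^ (d + 1) * p₀ x ≤ Q * c368 d δ := by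
    have h := lineSum_profileAt_col L hL1 (kingVol L jv) hQ.le hδ0 jv.K 0 (y υ₀)
    rw [← h1K, Real.one_rpow, mul_one] at h
    exact h
  have hΓ' : ∑ x, (((L : ℝ) ^ jv.K)⁻¹) ^ (d + 1) * r₀ x ≤ Q * θE * c368 d δ := by
    have h := lineSum_profileAt_col L hL1 (kingVol L jv) (mul_nonneg hθE0 hQ.le) hδ0 jv.K 0 (y υ₀)
    rw [← h1K, Real.one_rpow, mul_one] at h
    refine h.trans (le_of_eq ?_); ring
  -- apply part Α-f
  have key := H msq hm hcap jv n hn nn m src tgt hconn κ hsub Υ vtx υ₀ hυ₀ (fun υ => some (y υ)) δ hδ0.le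
    (fun υ => kingExtLo L a msq jv (b υ) (κe υ)) (fun υ => kingExtHi L a msq jv n (b υ) (κe υ))
    (fun _ => Q) (fun _ => θE) p₀ r₀ (Q * c368 d δ) (Q * θE * c368 d δ)
    (fun _ => hQ.le) (fun _ => hθE0) hp₀0 hr₀0
    (fun υ _ x => by
      have h := (HL υ).1 x
      rw [hsplit] at h
      exact h.trans (le_of_eq (by ring)) |>.trans (mul_le_mul_of_nonneg_right (mul_le_of_le_one_right hQ.le (hw1 x _)) (legWeight_pos _ _ _ _).le))
    (fun υ _ x' => by
      have h := (HL υ).2.1 x'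
      rw [hsplit] at h
      exact h.trans (le_of_eq (by ring)) |>.trans (mul_le_mul_of_nonneg_right (mul_le_of_le_one_right hQ.le (hw1 _ _)) (legWeight_pos _ _ _ _).le))
    (fun υ _ x' => by
      have h := (HL υ).2.2 x'
      rw [hsplit] at h
      exact h.trans (le_of_eq (by ring)) |>.trans
        (mul_le_mul_of_nonneg_right (mul_le_of_le_one_right (mul_nonneg hθE0 hQ.le) (hw1 _ _)) (legWeight_pos _ _ _ _).le))
    (fun x => by have h := (HL υ₀).1 x; rw [hsplit] at h; rw [hp₀eq]; exact h.trans (le_of_eq (by ring)))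
    (fun x' => by have h := (HL υ₀).2.1 x'; rw [hsplit] at h; rw [hp₀eq]; exact h.trans (le_of_eq (by ring)))
    (fun x' => by have h := (HL υ₀).2.2 x'; rw [hsplit] at h; rw [hr₀eq]; exact h.trans (le_of_eq (by ring)))
    hΓ hΓ'
  -- the statement's shape: `min δ₁ δ = δ`, `min γ₀ ¼ ≥ min γ ¼`, `γE ≥ γ`
  have hminδ : min δ₁ δ = δ := min_eq_right (min_le_left _ _)
  rw [hminδ] at key
  refine key.trans (mul_le_mul_of_nonneg_left ?_ (Real.exp_nonneg _))
  have hγγE : γ ≤ γE := min_le_right _ _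
  have hγγ₀ : min γ (1 / 4) ≤ min γ₀ (1 / 4) := min_le_min (min_le_left _ _) le_rfl
  have hKr : (0 : ℝ) ≤ jv.K := Nat.cast_nonneg _
  have hθEle : θE ≤ (L : ℝ) ^ (-(γ * jv.K)) :=
    Real.rpow_le_rpow_of_exponent_le hL1r (neg_le_neg (mul_le_mul_of_nonneg_right hγγE hKr))
  have hθ₀le : (L : ℝ) ^ (-(min γ₀ (1 / 4) * jv.K)) ≤ (L : ℝ) ^ (-(min γ (1 / 4) * jv.K)) :=
    Real.rpow_le_rpow_of_exponent_le hL1r (neg_le_neg (mul_le_mul_of_nonneg_right hγγ₀ hKr))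
  have hc0 : 0 ≤ c368 d δ := (c368_pos d hδ0).le
  have hB0 : 0 ≤ C₁ ^ m * C₂ ^ nn * ((m.factorial : ℝ) * ((1 - (L : ℝ) ^ (-(1 / 4 : ℝ)))⁻¹) ^ m) * ∏ _υ ∈ univ.erase υ₀, Q := by
    have hgeom : 0 ≤ ((1 - (L : ℝ) ^ (-(1 / 4 : ℝ)))⁻¹) := by
      refine inv_nonneg.2 (sub_nonneg.2 (Real.rpow_le_one_of_one_le_of_nonpos hL1r (by norm_num)))
    exact mul_nonneg (mul_nonneg (mul_nonneg (pow_nonneg hC₁.le _) (pow_nonneg hC₂.le _)) (mul_nonneg (Nat.cast_nonneg _) (pow_nonneg hgeom _)))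
      (prod_nonneg fun _ _ => hQ.le)
  refine mul_le_mul_of_nonneg_right ?_ hB0
  refine add_le_add ?_ (mul_le_mul_of_nonneg_left (add_le_add (mul_le_mul_of_nonneg_right hθ₀le (by positivity))
    (sum_le_sum fun _ _ => hθEle)) (mul_nonneg hQ.le hc0))
  calc Q * θE * c368 d δ = Q * (θE * c368 d δ) := by ring
    _ ≤ Q * ((L : ℝ) ^ (-(γ * jv.K)) * c368 d δ) := mul_le_mul_of_nonneg_left (mul_le_mul_of_nonneg_right hθEle hc0) hQ.le
    _ = Q * (L : ℝ) ^ (-(γ * jv.K)) * c368 d δ := by ring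

/-- ★★ **TWO EXTERNAL POINTS: THE η-DIFFERENCE DECAYS EXPONENTIALLY IN THEIR SEPARATION** — the previous theorem read through part Α-f
`exp_treeLength_le_exp_pair`: for any two external lines `υ₀` (at the vertex `0`) and `υ₁` of the family, the bound holds with `exp[−δ|y_{υ₀} − y_{υ₁}|]` in place
of the tree decay (all other external points only help).  The shape in which (3.56) is consumed for the two-point function.
[cite: King1986, Prop. 3.6 (3.56) p.662, p.660 («the length of the shortest tree graph connecting {u_i}»)] -/
theorem king_prop36_extLegs_pairDecay (hLodd : Odd L) (hL : 2 ≤ L) {a : ℝ} (ha : 0 < a) {m0sq : ℝ} (hm0 : 0 ≤ m0sq) :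
    ∃ C₁ C₂ Q γ δ : ℝ, 0 < C₁ ∧ 0 < C₂ ∧ 0 < Q ∧ 0 < γ ∧ 0 < δ ∧ ∀ (msq : ℝ), 0 < msq → msq ≤ m0sq → ∀ (jv : KingVolIndex d) (n : ℕ), 1 ≤ n →
      ∀ (nn m : ℕ) (src tgt : Fin m → Fin (nn + 1)), (∀ v, LConn src tgt univ 0 v) →
      ∀ (κ : Fin m → Option (Fin (d + 1))), PosSubgraphsBy src tgt 0 ((d + 1 : ℕ) : ℝ) (fun ℓ => lineExp (d + 1) (κ ℓ)) →
      ∀ (Υ : Type) [Fintype Υ] [DecidableEq Υ] (vtx : Υ → Fin (nn + 1)) (υ₀ υ₁ : Υ), vtx υ₀ = 0 →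
      ∀ (b : Υ → Tor (kingVol L jv)) (κe : Υ → Option (Fin (d + 1))),
        haveI := kingVol_neZero L jv
        |graphValLS ((((L : ℝ) ^ (jv.K + n))⁻¹) ^ (d + 1)) src tgt (fun ℓ => kingGLine L (kingVol L jv) a msq (jv.K + n) (κ ℓ)) vtx
              (fun υ => kingExtHi L a msq jv n (b υ) (κe υ))
            - graphValLS ((((L : ℝ) ^ jv.K)⁻¹) ^ (d + 1)) src tgt (fun ℓ => kingGLine L (kingVol L jv) a msq jv.K (κ ℓ)) vtx
              (fun υ => kingExtLo L a msq jv (b υ) (κe υ))|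
          ≤ Real.exp (-(δ * kingDist L jv (basePt (L ^ jv.K) (kingVol L jv) (b υ₀)) (basePt (L ^ jv.K) (kingVol L jv) (b υ₁))))
            * ((Q * (L : ℝ) ^ (-(γ * jv.K)) * c368 d δ
                + Q * c368 d δ * ((L : ℝ) ^ (-(min γ (1 / 4) * jv.K)) * (m + 1) + ∑ _υ ∈ univ.erase υ₀, (L : ℝ) ^ (-(γ * jv.K))))
              * (C₁ ^ m * C₂ ^ nn * ((m.factorial : ℝ) * ((1 - (L : ℝ) ^ (-(1 / 4 : ℝ)))⁻¹) ^ m) * ∏ _υ ∈ univ.erase υ₀, Q)) := by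
  obtain ⟨C₁, C₂, Q, γ, δ, hC₁, hC₂, hQ, hγ, hδ, H⟩ := king_prop36_extLegs_treeDecay (d := d) L hLodd hL ha hm0
  refine ⟨C₁, C₂, Q, γ, δ, hC₁, hC₂, hQ, hγ, hδ, fun msq hm hcap jv n hn nn m src tgt hconn κ hsub Υ _ _ vtx υ₀ υ₁ hυ₀ b κe => ?_⟩
  haveI := kingVol_neZero L jv
  have hL1r : (1 : ℝ) ≤ L := by exact_mod_cast (show 1 ≤ L by omega)
  refine (H msq hm hcap jv n hn nn m src tgt hconn κ hsub Υ vtx υ₀ hυ₀ b κe).trans (mul_le_mul_of_nonneg_right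
    (exp_treeLength_le_exp_pair L jv (fun υ => some (basePt (L ^ jv.K) (kingVol L jv) (b υ))) (υ₁ := υ₀) (υ₂ := υ₁) rfl rfl hδ.le) ?_)
  have hc0 : 0 ≤ c368 d δ := (c368_pos d hδ).le
  have hgeom : 0 ≤ ((1 - (L : ℝ) ^ (-(1 / 4 : ℝ)))⁻¹) :=
    inv_nonneg.2 (sub_nonneg.2 (Real.rpow_le_one_of_one_le_of_nonpos hL1r (by norm_num)))
  have hr0 : ∀ t : ℝ, 0 ≤ (L : ℝ) ^ t := fun t => Real.rpow_nonneg (Nat.cast_nonneg L) t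
  refine mul_nonneg (add_nonneg (mul_nonneg (mul_nonneg hQ.le (hr0 _)) hc0)
    (mul_nonneg (mul_nonneg hQ.le hc0) (add_nonneg (mul_nonneg (hr0 _) (by positivity)) (sum_nonneg fun _ _ => hr0 _)))) ?_
  exact mul_nonneg (mul_nonneg (mul_nonneg (pow_nonneg hC₁.le _) (pow_nonneg hC₂.le _)) (mul_nonneg (Nat.cast_nonneg _) (pow_nonneg hgeom _)))
    (prod_nonneg fun _ _ => hQ.le)

/-- ★★★ **(3.56) AS ONE READS IT: `|E^{(K+n)}(H) − E^{(K)}(H)| ≤ C(H)·L^{−γK}·exp[−δ d({y})]`** with `C(H) = A^{2m + nn + |Υ|}·m!·(m + |Υ| + 1)` for ONE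
`A ≥ 1` (depending on `a, m₀², L` only) — the previous theorem with its constants collected: every term of its middle factor carries `L^{−min(γ,¼)K}`, the
orderings constant `(1 − L^{−¼})^{−m}` and the per-line ∕ per-vertex ∕ per-leg constants are powers of `A`.  The graph-dependence `C(H)` (King: «the number of
graphs H depends only on n̄ and d»; the factorial is the sum over orderings (3.58)) is explicit; NOTHING depends on the volume or on `K`, `n`.
[cite: King1986, Prop. 3.6 (3.56) p.662, (3.58) p.663, p.664] -/
theorem king_prop36_extLegs_treeDecay_collected (hLodd : Odd L) (hL : 2 ≤ L) {a : ℝ} (ha : 0 < a) {m0sq : ℝ} (hm0 : 0 ≤ m0sq) :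
    ∃ A γ δ : ℝ, 1 ≤ A ∧ 0 < γ ∧ 0 < δ ∧ ∀ (msq : ℝ), 0 < msq → msq ≤ m0sq → ∀ (jv : KingVolIndex d) (n : ℕ), 1 ≤ n →
      ∀ (nn m : ℕ) (src tgt : Fin m → Fin (nn + 1)), (∀ v, LConn src tgt univ 0 v) →
      ∀ (κ : Fin m → Option (Fin (d + 1))), PosSubgraphsBy src tgt 0 ((d + 1 : ℕ) : ℝ) (fun ℓ => lineExp (d + 1) (κ ℓ)) →
      ∀ (Υ : Type) [Fintype Υ] [DecidableEq Υ] (vtx : Υ → Fin (nn + 1)) (υ₀ : Υ), vtx υ₀ = 0 →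
      ∀ (b : Υ → Tor (kingVol L jv)) (κe : Υ → Option (Fin (d + 1))),
        haveI := kingVol_neZero L jv
        |graphValLS ((((L : ℝ) ^ (jv.K + n))⁻¹) ^ (d + 1)) src tgt (fun ℓ => kingGLine L (kingVol L jv) a msq (jv.K + n) (κ ℓ)) vtx
              (fun υ => kingExtHi L a msq jv n (b υ) (κe υ))
            - graphValLS ((((L : ℝ) ^ jv.K)⁻¹) ^ (d + 1)) src tgt (fun ℓ => kingGLine L (kingVol L jv) a msq jv.K (κ ℓ)) vtx
              (fun υ => kingExtLo L a msq jv (b υ) (κe υ))|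
          ≤ Real.exp (-(δ * treeLength (kingDist L jv) (anchors fun υ => some (basePt (L ^ jv.K) (kingVol L jv) (b υ)))))
            * (L : ℝ) ^ (-(γ * jv.K)) * (A ^ (2 * m + nn + Fintype.card Υ) * ((m.factorial : ℝ) * (m + Fintype.card Υ + 1))) := by
  obtain ⟨C₁, C₂, Q, γ, δ, hC₁, hC₂, hQ, hγ, hδ, H⟩ := king_prop36_extLegs_treeDecay (d := d) L hLodd hL ha hm0
  have hL1r : (1 : ℝ) < L := by exact_mod_cast (show 1 < L by omega)
  have hL1 : (1 : ℝ) ≤ L := hL1r.le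
  set g : ℝ := (1 - (L : ℝ) ^ (-(1 / 4 : ℝ)))⁻¹ with hgdef
  have hq1 : (L : ℝ) ^ (-(1 / 4 : ℝ)) < 1 := Real.rpow_lt_one_of_one_lt_of_neg hL1r (by norm_num)
  have hq0 : 0 < (L : ℝ) ^ (-(1 / 4 : ℝ)) := Real.rpow_pos_of_pos (by linarith) _
  have hg1 : 1 ≤ g := by rw [hgdef]; exact (one_le_inv₀ (by linarith)).2 (by linarith)
  set c : ℝ := c368 d δ with hcdef
  have hc0 : 0 < c := c368_pos d hδ
  set A : ℝ := 1 + C₁ + C₂ + Q + Q * c + g with hA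
  have hA1 : 1 ≤ A := by rw [hA]; nlinarith [mul_pos hQ hc0]
  have hA0 : 0 ≤ A := zero_le_one.trans hA1
  have hC₁A : C₁ ≤ A := by rw [hA]; nlinarith [mul_pos hQ hc0]
  have hC₂A : C₂ ≤ A := by rw [hA]; nlinarith [mul_pos hQ hc0]
  have hQA : Q ≤ A := by rw [hA]; nlinarith [mul_pos hQ hc0]
  have hQcA : Q * c ≤ A := by rw [hA]; nlinarith
  have hgA : g ≤ A := by rw [hA]; nlinarith [mul_pos hQ hc0]
  refine ⟨A, min γ (1 / 4), δ, hA1, lt_min hγ (by norm_num), hδ, fun msq hm hcap jv n hn nn m src tgt hconn κ hsub Υ _ _ vtx υ₀ hυ₀ b κe => ?_⟩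
  haveI := kingVol_neZero L jv
  refine (H msq hm hcap jv n hn nn m src tgt hconn κ hsub Υ vtx υ₀ hυ₀ b κe).trans ?_
  set θ : ℝ := (L : ℝ) ^ (-(min γ (1 / 4) * jv.K)) with hθ
  set θγ : ℝ := (L : ℝ) ^ (-(γ * jv.K)) with hθγ
  have hθ0 : 0 ≤ θ := Real.rpow_nonneg (by linarith) _
  have hKr : (0 : ℝ) ≤ jv.K := Nat.cast_nonneg _
  have hθγθ : θγ ≤ θ := Real.rpow_le_rpow_of_exponent_le hL1 (neg_le_neg (mul_le_mul_of_nonneg_right (min_le_left _ _) hKr))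
  set N : ℕ := Fintype.card Υ with hN
  have hN1 : 1 ≤ N := Fintype.card_pos_iff.2 ⟨υ₀⟩
  have hcardE : (univ.erase υ₀).card = N - 1 := by rw [card_erase_of_mem (mem_univ υ₀), card_univ]
  have hNr : (((N - 1 : ℕ) : ℝ)) = (N : ℝ) - 1 := by rw [Nat.cast_sub hN1, Nat.cast_one]
  -- the middle factor: every term carries `θ`
  have hS : Q * θγ * c + Q * c * (θ * (m + 1) + ∑ _υ ∈ univ.erase υ₀, θγ) ≤ A * θ * (m + N + 1) := by
    rw [sum_const, hcardE, nsmul_eq_mul, hNr]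
    have h1 : Q * θγ * c ≤ Q * c * θ := by nlinarith [mul_le_mul_of_nonneg_left hθγθ (mul_pos hQ hc0).le]
    have h2 : ((N : ℝ) - 1) * θγ ≤ ((N : ℝ) - 1) * θ := mul_le_mul_of_nonneg_left hθγθ (by rw [← hNr]; exact Nat.cast_nonneg _)
    have h3 : Q * c * θ * ((m : ℝ) + N + 1) ≤ A * θ * (m + N + 1) :=
      mul_le_mul_of_nonneg_right (mul_le_mul_of_nonneg_right hQcA hθ0) (by positivity)
    nlinarith [mul_le_mul_of_nonneg_left h2 (mul_pos hQ hc0).le, mul_pos hQ hc0]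
  -- the product of constants: powers of `A`
  have hP : C₁ ^ m * C₂ ^ nn * ((m.factorial : ℝ) * g ^ m) * ∏ _υ ∈ univ.erase υ₀, Q ≤ (m.factorial : ℝ) * A ^ (2 * m + nn + N - 1) := by
    rw [prod_const, hcardE]
    have e : (m.factorial : ℝ) * A ^ (2 * m + nn + N - 1) = A ^ m * A ^ nn * ((m.factorial : ℝ) * A ^ m) * A ^ (N - 1) := by
      rw [show 2 * m + nn + N - 1 = m + nn + m + (N - 1) by omega, pow_add, pow_add, pow_add]; ring
    rw [e]
    have hgm : g ^ m ≤ A ^ m := pow_le_pow_left₀ (zero_le_one.trans hg1) hgA m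
    exact mul_le_mul (mul_le_mul (mul_le_mul (pow_le_pow_left₀ hC₁.le hC₁A m) (pow_le_pow_left₀ hC₂.le hC₂A nn) (pow_nonneg hC₂.le _)
      (pow_nonneg hA0 _)) (mul_le_mul_of_nonneg_left hgm (Nat.cast_nonneg _)) (by positivity) (by positivity))
      (pow_le_pow_left₀ hQ.le hQA _) (pow_nonneg hQ.le _) (by positivity)
  -- assemble
  have hS0 : 0 ≤ Q * θγ * c + Q * c * (θ * (m + 1) + ∑ _υ ∈ univ.erase υ₀, θγ) := by
    have : 0 ≤ θγ := Real.rpow_nonneg (by linarith) _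
    positivity
  rw [mul_assoc (Real.exp _)]
  refine mul_le_mul_of_nonneg_left ?_ (Real.exp_nonneg _)
  calc (Q * θγ * c + Q * c * (θ * (m + 1) + ∑ _υ ∈ univ.erase υ₀, θγ))
        * (C₁ ^ m * C₂ ^ nn * ((m.factorial : ℝ) * g ^ m) * ∏ _υ ∈ univ.erase υ₀, Q)
      ≤ (A * θ * (m + N + 1)) * ((m.factorial : ℝ) * A ^ (2 * m + nn + N - 1)) :=
        mul_le_mul hS hP (mul_nonneg (mul_nonneg (mul_nonneg (pow_nonneg hC₁.le _) (pow_nonneg hC₂.le _)) (by positivity))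
          (prod_nonneg fun _ _ => hQ.le)) (by positivity)
    _ = θ * (A ^ (2 * m + nn + N - 1 + 1) * ((m.factorial : ℝ) * (m + N + 1))) := by rw [pow_succ]; ring
    _ = θ * (A ^ (2 * m + nn + N) * ((m.factorial : ℝ) * (m + N + 1))) := by
        rw [show 2 * m + nn + N - 1 + 1 = 2 * m + nn + N by omega]

end ExtLegs

end Summit.QuantumFields.YangMills.BalabanUVNodes.N15KingModelRung.Curved

end
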